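import Summits.CriticalPhenomena.SAWScalingLimit.Theorems.SAWLoopFugacityFlowIsingBoundaryRatioWindowExtResistanceChart
import HarnessLib

/-!
# Resistance bound for the window rectangle — one side of a chart semicircle
(line `fk-anchor-transfer`, crux `IsingBoundaryRatio`, stmt-CriticalPhenomena-10650; helper module of the proof of
`WindowExtResistanceBound`, `…IsingBoundaryRatioWindowResistanceDefs.lean`)

`wer_side_vertex`: the face-chain extraction `wer_extraction` (`…WindowExtResistanceExtract.lean`) applied to
one half `Γ = φ(e^{s+iθ}), θ ∈ [θlo, θhi]` (`0 < θlo ≤ π/2 ≤ θhi < π`) of the chart semicircle of radius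
`r = e^s ∈ (r₁' + 2m, r₂' - 2m)` of a presented window rectangle
`IsWindowRect D φ M ε δ ρ r₁ r₂ r₁' r₂' Λ E d₀ n`, under the standing chart hypotheses of
`wer_chart_setup` (`…WindowExtResistanceChart.lean`: extension `g` of `φ⁻¹`, compact `B`, modulus `η` for
the margin `m`, deep points have full `Ω_δ`-neighbourhoods) and given an end angle `θe ∈ [θlo, θhi]` at
which the semicircle is within `δ/8` of `∂D`. Conclusion: a boundary vertex `u` of `E` of inner chart
radius (`∈ [r₁', r₂']`), with chart point of negative real part if `cos ≤ 0` on `[θlo, θhi]` and of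
positive real part if `cos ≥ 0` there — so `u` lies on arc `0`, resp. arc `2`, by
`IsWindowRect.arc0_sup/arc2_sup` — joined to the lower-left corner of the cell of the top point `φ(i r)`
by a walk of `⟨E⟩` all of whose vertices are within `5δ` of points of the open semicircle.

Proof: the hypotheses of `wer_extraction` are checked with `Good x = (r₁' ≤ |ψ x| ≤ r₂')`,
`Win x = (x ∈ Λ` is a window site`)`, `Deep z = (m ≤ im g z)`: lattice sites of `Ω_δ` within `8δ` of the
semicircle have chart point within `m` of the corresponding point `e^{s+iθ}` (uniform continuity of `g` on
`B`), hence inner chart radius, and are window sites of `Λ` (the volume contains the chart disc; the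
chart disc lies in `B(a, ε)`); relative closedness is `IsWindowRect.closed`; the corners of the top cell
are cone sites of the inner window, hence vertices of `E` (`IsWindowRect.bulk_mem`). The extracted vertex
`u` is within `4δ` of the end point — whose chart point has imaginary part `< m`, the nearby frontier point
having a real chart value — or within `2δ` of a non-deep point of `Γ`; in both cases its chart point is
within `m` of a point `r e^{iθ}` with `|im| < m`, whose real part is `< -m`, resp. `> m`
(`wer_re_lt_neg`, `wer_lt_re`).
-/

noncomputable section

open scoped Classical Topology ENNReal NNReal
open Filter Set Metric SimpleGraph MeasureTheory Complex
open Literature.Probability.LatticeModels Literature.Probability.RandomPlanarGeometry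
open Literature.Probability.Percolation (BondConfig)
open UpperHalfPlane (upperHalfPlaneSet)

namespace Summit.CriticalPhenomena.SAWScalingLimit.Theorems.IsingBoundaryRatio

/-- **One side of the chart semicircle yields a boundary vertex of `E` of the right kind** (see the module
docstring for the statement and the proof). [folklore] -/
theorem wer_side_vertex {D : DobrushinDomain} {φ : ConformalEquiv upperHalfPlaneSet D.carrier}
    {M ε δ ρ r₁ r₂ r₁' r₂' : ℝ} {Λ : Finset (Site 2)} {E : Finset (Sym2 (Site 2))} {d₀ : Site 2 × Fin 4}
    {n : Fin 4 → ℕ} (hW : IsWindowRect D φ M ε δ ρ r₁ r₂ r₁' r₂' Λ E d₀ n)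
    (hΛ : ∀ x ∈ meshDomain D.carrier δ, ‖φ.symm (meshPoint δ x)‖ < M * ρ → x ∈ Λ)
    {g : ℂ → ℂ} {B : Set ℂ} {η d m r₀ : ℝ} (hδ : 0 < δ)
    (hgeq : EqOn g φ.symm D.carrier)
    (hgfr : ∀ z ∈ B, z ∈ frontier D.carrier → (g z).im = 0)
    (hmemB : ∀ z ∈ D.carrier, ‖φ.symm z‖ ≤ M * ρ → ∀ z' ∈ closure D.carrier, dist z' z ≤ d → z' ∈ B)
    (hηg : ∀ z ∈ B, ∀ z' ∈ B, dist z z' < η → dist (g z) (g z') < m)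
    (hδη : 16 * δ < η) (hδd : 16 * δ < d)
    (hdeep : ∀ z ∈ D.carrier, ‖φ.symm z‖ ≤ M * ρ → m ≤ (φ.symm z).im → ∀ x : Site 2,
      dist (meshPoint δ x) z ≤ 3 * δ → x ∈ meshDomain D.carrier δ ∧
        ∀ k : Fin 4, (discreteDomainGraph D.carrier δ).Adj x (x + DiscreteRect.dir k))
    (hball : ∀ w ∈ upperHalfPlaneSet, ‖w‖ < r₀ → φ w ∈ ball (D.pt 0) ε) (hMρ : M * ρ ≤ r₀)
    (h1 : ρ < r₁) (h1' : r₁ ≤ r₁') (h2' : r₂' ≤ r₂) (h2 : r₂ < M * ρ) (hm : 0 < m) (hmr : 8 * m ≤ r₁')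
    {s : ℝ} (hs1 : r₁' + 2 * m < Real.exp s) (hs2 : Real.exp s < r₂' - 2 * m)
    {θlo θhi θe : ℝ} (hlo : 0 < θlo) (hlo' : θlo ≤ Real.pi / 2) (hhi' : Real.pi / 2 ≤ θhi) (hhi : θhi < Real.pi)
    (he : θe ∈ Icc θlo θhi) {p : ℂ} (hp : p ∈ frontier D.carrier)
    (hpe : dist p (φ (exp ((s : ℂ) + (θe : ℂ) * I))) < δ / 8) :
    ∃ u ∈ DiscreteRect.bdVerts E,
      r₁' ≤ ‖φ.symm (meshPoint δ u)‖ ∧ ‖φ.symm (meshPoint δ u)‖ ≤ r₂' ∧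
      ((∀ θ ∈ Icc θlo θhi, Real.cos θ ≤ 0) → (φ.symm (meshPoint δ u)).re < 0) ∧
      ((∀ θ ∈ Icc θlo θhi, 0 ≤ Real.cos θ) → 0 < (φ.symm (meshPoint δ u)).re) ∧
      ∃ w : (fromEdgeSet (↑E : Set (Sym2 (Site 2)))).Walk
          (Mesh.corner ⌊(φ (exp ((s : ℂ) + ((Real.pi / 2 : ℝ) : ℂ) * I))).re / δ⌋
            ⌊(φ (exp ((s : ℂ) + ((Real.pi / 2 : ℝ) : ℂ) * I))).im / δ⌋ false false) u,
        ∀ x ∈ w.support, ∃ θ ∈ Ioo 0 Real.pi, dist (φ (exp ((s : ℂ) + (θ : ℂ) * I))) (meshPoint δ x) ≤ 5 * δ := by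
  set r := Real.exp s with hr
  set γ : ℝ → ℂ := fun θ => φ (exp ((s : ℂ) + (θ : ℂ) * I)) with hγ
  set Γ : Set ℂ := γ '' Icc θlo θhi with hΓ
  set Ω := discreteDomainGraph D.carrier δ with hΩ
  have hπ := Real.pi_pos
  have hIcc : ∀ θ ∈ Icc θlo θhi, θ ∈ Ioo 0 Real.pi := fun θ hθ => ⟨hlo.trans_le hθ.1, hθ.2.trans_lt hhi⟩
  have hmid : Real.pi / 2 ∈ Icc θlo θhi := ⟨hlo', hhi'⟩
  -- points of the semicircle
  have hwθ : ∀ θ : ℝ, ‖exp ((s : ℂ) + (θ : ℂ) * I)‖ = r := fun θ => (wer_exp_polar s θ).1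
  have hγD : ∀ θ ∈ Ioo 0 Real.pi, γ θ ∈ D.carrier := fun θ hθ => φ.mapsTo (wer_exp_mem_uhp s hθ)
  have hγg : ∀ θ ∈ Ioo 0 Real.pi, φ.symm (γ θ) = exp ((s : ℂ) + (θ : ℂ) * I) := fun θ hθ =>
    φ.symm_apply_apply (wer_exp_mem_uhp s hθ)
  have hrM : r ≤ M * ρ := by linarith
  have hγrad : ∀ θ ∈ Ioo 0 Real.pi, ‖φ.symm (γ θ)‖ ≤ M * ρ := fun θ hθ => by rw [hγg θ hθ, hwθ]; exact hrM
  -- transfer of chart information to nearby points of `closure D`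
  have hclose : ∀ θ ∈ Ioo 0 Real.pi, ∀ q ∈ closure D.carrier, dist q (γ θ) ≤ 8 * δ →
      q ∈ B ∧ dist (g q) (exp ((s : ℂ) + (θ : ℂ) * I)) < m := by
    intro θ hθ q hq hd
    have hqB : q ∈ B := hmemB (γ θ) (hγD θ hθ) (hγrad θ hθ) q hq (by linarith)
    have hzB : γ θ ∈ B := hmemB (γ θ) (hγD θ hθ) (hγrad θ hθ) (γ θ) (subset_closure (hγD θ hθ))
      (by rw [_root_.dist_self]; linarith)
    have := hηg q hqB (γ θ) hzB (by linarith)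
    rw [hgeq (hγD θ hθ), hγg θ hθ] at this
    exact ⟨hqB, this⟩
  -- lattice sites near the semicircle: chart radius, window membership
  have hsite : ∀ x ∈ meshDomain D.carrier δ, ∀ θ ∈ Ioo 0 Real.pi, dist (meshPoint δ x) (γ θ) ≤ 8 * δ →
      (r₁' ≤ ‖φ.symm (meshPoint δ x)‖ ∧ ‖φ.symm (meshPoint δ x)‖ ≤ r₂') ∧
      (∃ hx : x ∈ Λ, (⟨x, hx⟩ : ↥Λ) ∈ annWindow D φ M ε δ ρ r₁ r₂ Λ) ∧
      dist (φ.symm (meshPoint δ x)) (exp ((s : ℂ) + (θ : ℂ) * I)) < m := by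
    intro x hx θ hθ hd
    have hxD : meshPoint δ x ∈ D.carrier := meshDomain_subset_meshVertices _ _ hx
    obtain ⟨-, hdist⟩ := hclose θ hθ _ (subset_closure hxD) hd
    rw [hgeq hxD] at hdist
    have hn1 : ‖φ.symm (meshPoint δ x)‖ < r + m := by
      have := norm_sub_norm_le (φ.symm (meshPoint δ x)) (exp ((s : ℂ) + (θ : ℂ) * I))
      rw [← dist_eq_norm, hwθ] at this; linarith
    have hn2 : r - m < ‖φ.symm (meshPoint δ x)‖ := by
      have := norm_sub_norm_le (exp ((s : ℂ) + (θ : ℂ) * I)) (φ.symm (meshPoint δ x))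
      rw [← dist_eq_norm, _root_.dist_comm, hwθ] at this; linarith
    have hxΛ : x ∈ Λ := hΛ x hx (by linarith)
    have hball' : meshPoint δ x ∈ ball (D.pt 0) ε := by
      have := hball (φ.symm (meshPoint δ x)) (φ.symm_mapsTo hxD) (by linarith)
      rwa [φ.apply_symm_apply hxD] at this
    exact ⟨⟨by linarith, by linarith⟩, ⟨hxΛ, ⟨hball', by linarith, by linarith⟩, by linarith, by linarith⟩, hdist⟩
  -- the connected set `Γ`
  have hγc : ContinuousOn γ (Ioo 0 Real.pi) := by
    refine φ.continuousOn.comp (by fun_prop : Continuous fun θ : ℝ => exp ((s : ℂ) + (θ : ℂ) * I)).continuousOn ?_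
    exact fun θ hθ => wer_exp_mem_uhp s hθ
  have hΓc : IsPreconnected Γ := isPreconnected_Icc.image γ (hγc.mono fun θ hθ => hIcc θ hθ)
  have hΓD : Γ ⊆ D.carrier := by
    rintro _ ⟨θ, hθ, rfl⟩; exact hγD θ (hIcc θ hθ)
  have hΓb : Bornology.IsBounded Γ := D.isBounded.subset hΓD
  have hΓne : Γ.Nonempty := ⟨γ (Real.pi / 2), Real.pi / 2, hmid, rfl⟩
  have hnearΓ : ∀ {q : ℂ} {c : ℝ}, infDist q Γ ≤ c → ∃ θ ∈ Icc θlo θhi, dist q (γ θ) < c + δ := by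
    intro q c hq
    obtain ⟨_, ⟨θ, hθ, rfl⟩, hd⟩ := (Metric.infDist_lt_iff hΓne).1 (show infDist q Γ < c + δ by linarith)
    exact ⟨θ, hθ, hd⟩
  -- hypotheses of the extraction lemma
  have hnear : ∀ x : Site 2, x ∈ meshDomain D.carrier δ → infDist (meshPoint δ x) Γ ≤ 3 * δ →
      (r₁' ≤ ‖φ.symm (meshPoint δ x)‖ ∧ ‖φ.symm (meshPoint δ x)‖ ≤ r₂') ∧
      (∃ hx : x ∈ Λ, (⟨x, hx⟩ : ↥Λ) ∈ annWindow D φ M ε δ ρ r₁ r₂ Λ) := by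
    intro x hx hinf
    obtain ⟨θ, hθ, hd⟩ := hnearΓ hinf
    obtain ⟨hg, hw, -⟩ := hsite x hx θ (hIcc θ hθ) (by linarith)
    exact ⟨hg, hw⟩
  have hclosed : ∀ x y : Site 2, x ∈ DiscreteRect.verts E →
      (r₁' ≤ ‖φ.symm (meshPoint δ x)‖ ∧ ‖φ.symm (meshPoint δ x)‖ ≤ r₂') →
      (∃ hy : y ∈ Λ, (⟨y, hy⟩ : ↥Λ) ∈ annWindow D φ M ε δ ρ r₁ r₂ Λ) → Ω.Adj x y → s(x, y) ∈ E := by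
    rintro x y hxv ⟨hr1, hr2⟩ ⟨hy, hwin⟩ hadj
    exact hW.closed x y hy hxv hr1 hr2 hadj hwin
  have hdeep' : ∀ z ∈ Γ, m ≤ (g z).im → ∀ x : Site 2, dist (meshPoint δ x) z ≤ 2 * δ →
      ∀ k : Fin 4, Ω.Adj x (x + DiscreteRect.dir k) := by
    rintro _ ⟨θ, hθ, rfl⟩ hzm x hx k
    rw [hgeq (hγD θ (hIcc θ hθ))] at hzm
    exact (hdeep (γ θ) (hγD θ (hIcc θ hθ)) (hγrad θ (hIcc θ hθ)) hzm x (by linarith)).2 k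
  -- the start cell at the top of the semicircle
  set z₀ : ℂ := γ (Real.pi / 2) with hz₀
  have hz₀Γ : z₀ ∈ Γ := ⟨Real.pi / 2, hmid, rfl⟩
  have hmid' : Real.pi / 2 ∈ Ioo 0 Real.pi := hIcc _ hmid
  have hz₀g : g z₀ = exp ((s : ℂ) + ((Real.pi / 2 : ℝ) : ℂ) * I) := by
    rw [hgeq (hγD _ hmid'), hγg _ hmid']
  have hz₀im : (exp ((s : ℂ) + ((Real.pi / 2 : ℝ) : ℂ) * I)).im = r := by
    rw [(wer_exp_polar s _).2.2, Real.sin_pi_div_two, mul_one]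
  have hz₀re : (exp ((s : ℂ) + ((Real.pi / 2 : ℝ) : ℂ) * I)).re = 0 := by
    rw [(wer_exp_polar s _).2.1, Real.cos_pi_div_two, mul_zero]
  have hz₀deep : m ≤ (g z₀).im := by rw [hz₀g, hz₀im]; linarith
  have hz₀deep' : m ≤ (φ.symm z₀).im := by rwa [← hgeq (hγD _ hmid')]
  have hz₀c := wer_mem_closure_cell_floor hδ z₀
  have hQ₀ : ∀ a b, Mesh.corner ⌊z₀.re / δ⌋ ⌊z₀.im / δ⌋ a b ∈ DiscreteRect.verts E := by
    intro a b
    have hcd : dist (meshPoint δ (Mesh.corner ⌊z₀.re / δ⌋ ⌊z₀.im / δ⌋ a b)) z₀ ≤ 2 * δ :=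
      wer_dist_corner_le hδ hz₀c a b
    have hcD : Mesh.corner ⌊z₀.re / δ⌋ ⌊z₀.im / δ⌋ a b ∈ meshDomain D.carrier δ :=
      (hdeep z₀ (hγD _ hmid') (hγrad _ hmid') hz₀deep' _ (by linarith)).1
    obtain ⟨⟨hg1, hg2⟩, ⟨hxΛ, hwin⟩, hdist⟩ := hsite _ hcD _ hmid' (by linarith)
    refine hW.bulk_mem _ hxΛ hcD ⟨hwin.1, hg1, hg2⟩ ?_
    have hre := (Complex.abs_re_le_norm _).trans_lt (lt_of_le_of_lt (le_of_eq (dist_eq_norm _ _).symm) hdist)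
    have him := (Complex.abs_im_le_norm _).trans_lt (lt_of_le_of_lt (le_of_eq (dist_eq_norm _ _).symm) hdist)
    rw [Complex.sub_re, hz₀re, sub_zero] at hre
    rw [Complex.sub_im, hz₀im, abs_lt] at him
    exact hre.le.trans (by linarith)
  -- the end point
  have hz₁Γ : γ θe ∈ Γ := ⟨θe, he, rfl⟩
  obtain ⟨u, hubd, ⟨w, hw⟩, hdisj⟩ := wer_extraction D.toJordanDomain hδ hW.mem_edgeSet hclosed hΓc hΓb hnear
    hdeep' hz₀Γ hz₀c hz₀deep hQ₀ hz₁Γ hp hpe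
  have huv : u ∈ DiscreteRect.verts E := by obtain ⟨k, hk, -⟩ := hubd; exact hk
  have huD : u ∈ meshDomain D.carrier δ := wer_verts_subset hW.mem_edgeSet huv
  -- a semicircle angle whose chart point controls that of `u`
  have hkey : ∃ θ ∈ Icc θlo θhi, dist (φ.symm (meshPoint δ u)) (exp ((s : ℂ) + (θ : ℂ) * I)) < m ∧
      |(exp ((s : ℂ) + (θ : ℂ) * I)).im| < m ∧
      (r₁' ≤ ‖φ.symm (meshPoint δ u)‖ ∧ ‖φ.symm (meshPoint δ u)‖ ≤ r₂') := by
    rcases hdisj with hd | ⟨_, ⟨θ', hθ', rfl⟩, hnd, hd⟩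
    · obtain ⟨hg, -, hdist⟩ := hsite u huD θe (hIcc θe he) (by linarith)
      refine ⟨θe, he, hdist, ?_, hg⟩
      obtain ⟨hpB, hpd⟩ := hclose θe (hIcc θe he) p (frontier_subset_closure hp) (by linarith)
      have him := (Complex.abs_im_le_norm _).trans_lt (lt_of_le_of_lt (le_of_eq (dist_eq_norm _ _).symm) hpd)
      rw [Complex.sub_im, hgfr p hpB hp, zero_sub, abs_neg] at him
      exact him
    · obtain ⟨hg, -, hdist⟩ := hsite u huD θ' (hIcc θ' hθ') (by linarith)
      refine ⟨θ', hθ', hdist, ?_, hg⟩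
      rw [hgeq (hγD θ' (hIcc θ' hθ')), hγg θ' (hIcc θ' hθ'), not_le] at hnd
      have hnn : 0 ≤ (exp ((s : ℂ) + (θ' : ℂ) * I)).im := le_of_lt (wer_exp_mem_uhp s (hIcc θ' hθ'))
      rwa [abs_of_nonneg hnn]
  obtain ⟨θs, hθs, hdu, hims, hgood⟩ := hkey
  have hnorm : 2 * m ≤ ‖exp ((s : ℂ) + (θs : ℂ) * I)‖ := by rw [hwθ]; linarith
  have hre_s : (exp ((s : ℂ) + (θs : ℂ) * I)).re = r * Real.cos θs := (wer_exp_polar s θs).2.1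
  have hredist : |(φ.symm (meshPoint δ u)).re - (exp ((s : ℂ) + (θs : ℂ) * I)).re| < m := by
    have := (Complex.abs_re_le_norm _).trans_lt (lt_of_le_of_lt (le_of_eq (dist_eq_norm _ _).symm) hdu)
    rwa [Complex.sub_re] at this
  refine ⟨u, hubd, hgood.1, hgood.2, fun hcos => ?_, fun hcos => ?_, w, fun x hx => ?_⟩
  · have hre0 : (exp ((s : ℂ) + (θs : ℂ) * I)).re ≤ 0 := by
      rw [hre_s]; exact mul_nonpos_of_nonneg_of_nonpos (Real.exp_pos s).le (hcos θs hθs)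
    have := wer_re_lt_neg hnorm hre0 hims
    rw [abs_lt] at hredist; linarith
  · have hre0 : 0 ≤ (exp ((s : ℂ) + (θs : ℂ) * I)).re := by
      rw [hre_s]; exact mul_nonneg (Real.exp_pos s).le (hcos θs hθs)
    have := wer_lt_re hnorm hre0 hims
    rw [abs_lt] at hredist; linarith
  · obtain ⟨θ, hθ, hd⟩ := hnearΓ (hw x hx)
    exact ⟨θ, hIcc θ hθ, by rw [_root_.dist_comm]; linarith⟩

/-- `wer_side_vertex`, closed form (registered sub-goal of stmt-CriticalPhenomena-10650). [folklore] -/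
theorem wer_side_vertex' : ∀ {D : DobrushinDomain} {φ : ConformalEquiv upperHalfPlaneSet D.carrier} {M ε δ ρ r₁ r₂ r₁' r₂' : ℝ} {Λ : Finset (Site 2)} {E : Finset (Sym2 (Site 2))} {d₀ : Site 2 × Fin 4} {n : Fin 4 → ℕ} (hW : IsWindowRect D φ M ε δ ρ r₁ r₂ r₁' r₂' Λ E d₀ n) (hΛ : ∀ x ∈ meshDomain D.carrier δ, ‖φ.symm (meshPoint δ x)‖ < M * ρ → x ∈ Λ) {g : ℂ → ℂ} {B : Set ℂ} {η d m r₀ : ℝ} (hδ : 0 < δ) (hgeq : EqOn g φ.symm D.carrier) (hgfr : ∀ z ∈ B, z ∈ frontier D.carrier → (g z).im = 0) (hmemB : ∀ z ∈ D.carrier, ‖φ.symm z‖ ≤ M * ρ → ∀ z' ∈ closure D.carrier, dist z' z ≤ d → z' ∈ B) (hηg : ∀ z ∈ B, ∀ z' ∈ B, dist z z' < η → dist (g z) (g z') < m) (hδη : 16 * δ < η) (hδd : 16 * δ < d) (hdeep : ∀ z ∈ D.carrier, ‖φ.symm z‖ ≤ M * ρ → m ≤ (φ.symm z).im → ∀ x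 : Site 2, dist (meshPoint δ x) z ≤ 3 * δ → x ∈ meshDomain D.carrier δ ∧ ∀ k : Fin 4, (discreteDomainGraph D.carrier δ).Adj x (x + DiscreteRect.dir k)) (hball : ∀ w ∈ upperHalfPlaneSet, ‖w‖ < r₀ → φ w ∈ ball (D.pt 0) ε) (hMρ : M * ρ ≤ r₀) (h1 : ρ < r₁) (h1' : r₁ ≤ r₁') (h2' : r₂' ≤ r₂) (h2 : r₂ < M * ρ) (hm : 0 < m) (hmr : 8 * m ≤ r₁') {s : ℝ} (hs1 : r₁' + 2 * m < Real.exp s) (hs2 : Real.exp s < r₂' - 2 * m) {θlo θhi θe : ℝ} (hlo : 0 < θlo) (hlo' : θlo ≤ Real.pi / 2) (hhi' : Real.pi / 2 ≤ θhi) (hhi : θhi < Real.pi) (he : θe ∈ Icc θlo θhi) {p : ℂ} (hp : p ∈ frontier D.carrier) (hpe : dist p (φ (exp ((s : ℂ) + (θe : ℂ) * I))) < δ / 8), ∃ u ∈ DiscreteRect.bdVerts E, r₁' ≤ ‖φ.symm (meshPoint δ u)‖ ∧ ‖φ.symm (meshPoint δ u)‖ ≤ r₂' ∧ ((∀ θ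 ∈ Icc θlo θhi, Real.cos θ ≤ 0) → (φ.symm (meshPoint δ u)).re < 0) ∧ ((∀ θ ∈ Icc θlo θhi, 0 ≤ Real.cos θ) → 0 < (φ.symm (meshPoint δ u)).re) ∧ ∃ w : (fromEdgeSet (↑E : Set (Sym2 (Site 2)))).Walk (Mesh.corner ⌊(φ (exp ((s : ℂ) + ((Real.pi / 2 : ℝ) : ℂ) * I))).re / δ⌋ ⌊(φ (exp ((s : ℂ) + ((Real.pi / 2 : ℝ) : ℂ) * I))).im / δ⌋ false false) u, ∀ x ∈ w.support, ∃ θ ∈ Ioo 0 Real.pi, dist (φ (exp ((s : ℂ) + (θ : ℂ) * I))) (meshPoint δ x) ≤ 5 * δ :=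
  fun hW hΛ _ _ _ _ _ _ hδ hgeq hgfr hmemB hηg hδη hδd hdeep hball hMρ h1 h1' h2' h2 hm hmr _ hs1 hs2 _ _ _ hlo hlo' hhi' hhi he _ hp hpe =>
    wer_side_vertex hW hΛ hδ hgeq hgfr hmemB hηg hδη hδd hdeep hball hMρ h1 h1' h2' h2 hm hmr hs1 hs2 hlo hlo' hhi' hhi he hp hpe

end Summit.CriticalPhenomena.SAWScalingLimit.Theorems.IsingBoundaryRatio

end
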